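import Summits.CriticalPhenomena.PercolationContinuityZ3.Theorems.PercNearOneGluingNoHeavyLowerTailSunflowerBernsteinCertificate
import HarnessLib

/-!
# `NoHeavyLowerTail` (crux stmt-CriticalPhenomena-4575), abstract sunflower cubic at LAW level: a FAST TABLE KERNEL for the
# reflected Bernstein checker (table-driven products and along-coordinate transforms, index tables built once)

Support file (seat `prim-ineq-gen-2` gen 33; `--supports stmt-CriticalPhenomena-4575`).  No `sorry`, no computation in this file.
Memo: run/shared/lean/prim/prim-ineq-gen-2/GLADKOV-SPLITTING-GEN33.md §1.

WHY.  prove-1 g38's `Bern` library (…SunflowerBernsteinPoly / …BernsteinCertificate) represents a polynomial as a FUNCTION on the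
exponent box and sums over `Fintype` universes of function types; compiled, one (C1) certificate for a 4-coin structure costs ≈ 1.6 s,
too slow for a census of all 74 229 four-coin sunflowers.  Here the same operations are done on coefficient TABLES with INDEX
TABLES (`digitTab`, `replTab`, `subTab`) that are computed once from `Bern.decode`/`Bern.encode` — so their correctness is just
`decode_encode` — and passed around in a record `Tabs n` (`mkTabs n`).  Soundness is proved against the reference semantics:
* `ofTable_alongTW` : `alongTW` (tables of `alTabs n d`) computes `Bern.along`;  `ofTable_backTW` : `backTW` computes `Bern.backL`;
* `eval_nonneg_of_certifyTW` : the fast certificate (`certifyTW`: forward transform, nonnegativity, exact backward check) implies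
  nonnegativity on the unit cube (via `Bern.eval_backLA`, `Bern.evalB_univ_nonneg`);
* `ofTable_mulTW` / `eval_mulTW` : `mulTW` (table `subTab n a b`) computes `Bern.mulFast` (reindexing by `expoEquiv`, `encode_decode`).
≈ 25× faster than the functional version in the (C1) pipeline (…SunflowerC1FastCertificate).
-/

namespace Summit.CriticalPhenomena.PercolationContinuityZ3.Theorems.SunflowerPartition

namespace SafeCalc

namespace C1Cert

open Finset Bern

variable {n : ℕ}

/-! ## FAST TABLE KERNEL: table-driven products and Bernstein transforms.  All index tables are built ONCE (from
`Bern.decode`/`Bern.encode`, so their correctness is `decode_encode`) and passed in a `Tabs` record; the soundness lemmas are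
stated for the canonical record `mkTabs n`. -/

/-- `encode ∘ decode = id` below `(d+1)^n`. [this work] -/
theorem encode_decode {d : ℕ} : ∀ (n k : ℕ), k < (d + 1) ^ n → encode n (decode (d := d) n k) = k
  | 0, k, hk => by simp only [encode, pow_zero] at hk ⊢; omega
  | n + 1, k, hk => by
    have hk' : k / (d + 1) < (d + 1) ^ n :=
      Nat.div_lt_of_lt_mul (by rw [pow_succ] at hk; linarith [hk])
    rw [decode, encode, Fin.cons_zero, Fin.tail_cons, encode_decode n (k / (d + 1)) hk']
    exact Nat.mod_add_div k (d + 1)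

/-- The exponent box `Expo n d` is in bijection with the index range `Fin ((d+1)^n)` via `encode`/`decode`. [this work] -/
def expoEquiv (n d : ℕ) : Expo n d ≃ Fin ((d + 1) ^ n) where
  toFun e := ⟨encode n e, encode_lt n e⟩
  invFun k := decode n k
  left_inv e := decode_encode n e
  right_inv k := Fin.ext (encode_decode n k k.2)

/-- Reading an `Array.ofFn` inside its range. [this work] -/
theorem getD_ofFn {α : Type} {N : ℕ} (f : Fin N → α) {i : ℕ} (h : i < N) (dflt : α) :
    (Array.ofFn f).getD i dflt = f ⟨i, h⟩ := by
  simp [Array.getD_eq_getD_getElem?, h]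

/-- `Σ_{i<m} f i` as a compiled loop (no intermediate list). [this work] -/
def sumBelow (m : ℕ) (f : (i : ℕ) → i < m → ℤ) : ℤ := Nat.fold m (fun i h acc => acc + f i h) 0

/-- The loop computes the sum. [this work] -/
theorem sumBelow_eq : ∀ (m : ℕ) (f : (i : ℕ) → i < m → ℤ), sumBelow m f = ∑ i : Fin m, f i i.2
  | 0, f => by simp [sumBelow]
  | m + 1, f => by
    rw [Fin.sum_univ_castSucc, sumBelow, Nat.fold_succ]
    have ih := sumBelow_eq m fun i h => f i (Nat.lt_succ_of_lt h)
    rw [sumBelow] at ih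
    rw [ih]
    rfl

/-! ### Along one coordinate -/

/-- Digit `v` of every index of the degree-`d` box. [this work] -/
def digitTab (n d : ℕ) (v : Fin n) : Array (Fin (d + 1)) :=
  Array.ofFn fun idx : Fin ((d + 1) ^ n) => decode (d := d) n idx v

/-- Index of `update (decode idx) v k`, for every `k` and `idx`. [this work] -/
def replTab (n d : ℕ) (v : Fin n) : Array (Array ℕ) :=
  Array.ofFn fun k : Fin (d + 1) => Array.ofFn fun idx : Fin ((d + 1) ^ n) =>
    encode n (Function.update (decode (d := d) n idx) v k)

/-- The per-coordinate index tables of the degree-`d` box. [this work] -/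
def alTabs (n d : ℕ) : Array (Array (Fin (d + 1)) × Array (Array ℕ)) :=
  Array.ofFn fun v : Fin n => (digitTab n d v, replTab n d v)

/-- Apply a `(d+1)×(d+1)` matrix along coordinate `v`, given that coordinate's index tables — TABLE version of `Bern.alongA`.
[this work] -/
def alongTW (n d : ℕ) (DR : Array (Fin (d + 1)) × Array (Array ℕ)) (M : Fin (d + 1) → Fin (d + 1) → ℤ) (X : Array ℤ) :
    Array ℤ :=
  Array.ofFn fun idx : Fin ((d + 1) ^ n) =>
    sumBelow (d + 1) fun k hk => M ⟨k, hk⟩ (DR.1.getD idx 0) * X.getD ((DR.2.getD k #[]).getD idx 0) 0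

/-- `alongTW` with the canonical tables computes `along`. [this work] -/
theorem ofTable_alongTW {d : ℕ} (v : Fin n) (M : Fin (d + 1) → Fin (d + 1) → ℤ) (X : Array ℤ) :
    ofTable n d (alongTW n d ((alTabs n d).getD v (#[], #[])) M X) = along v M (ofTable n d X) := by
  funext e
  have he := encode_lt n e
  rw [alTabs, getD_ofFn _ v.2, ofTable, alongTW, getD_ofFn _ he, sumBelow_eq]
  unfold along
  refine sum_congr rfl fun k _ => ?_
  have h1 : (digitTab n d v).getD (encode n e) 0 = e v := by
    rw [digitTab, getD_ofFn _ he]; simp only [decode_encode]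
  have h2 : ((replTab n d v).getD k #[]).getD (encode n e) 0 = encode n (Function.update e v k) := by
    rw [replTab, getD_ofFn _ k.2, getD_ofFn _ he]; simp only [decode_encode]
  simp only []
  rw [h1, h2, ofTable]

/-- Backward transform along a list of coordinates, table version. [this work] -/
def backTW (n d : ℕ) (AL : Array (Array (Fin (d + 1)) × Array (Array ℕ))) : List (Fin n) → Array ℤ → Array ℤ
  | [], A => A
  | v :: l, A => backTW n d AL l (alongTW n d (AL.getD v (#[], #[])) (fun k m => bern1 d k m) A)

/-- `backTW` with the canonical tables computes `backL`. [this work] -/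
theorem ofTable_backTW {d : ℕ} :
    ∀ (l : List (Fin n)) (A : Array ℤ), ofTable n d (backTW n d (alTabs n d) l A) = backL l (ofTable n d A)
  | [], A => rfl
  | v :: l, A => by rw [backTW, backL, ofTable_backTW l, ofTable_alongTW]

/-- Forward transform (proposes the Bernstein coefficients; its correctness is never used). [this work] -/
def fwdTW (n d : ℕ) (AL : Array (Array (Fin (d + 1)) × Array (Array ℕ))) (A : Array ℤ) : Array ℤ :=
  (List.finRange n).foldl (fun B v => alongTW n d (AL.getD v (#[], #[])) (fwdM d) B) A

/-- All entries with index `< N` are nonnegative. [this work] -/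
def nonnegOn (N : ℕ) (X : Array ℤ) : Bool := (List.range N).all fun i => decide (0 ≤ X.getD i 0)

/-- Two tables agree on the indices `< N`. [this work] -/
def agreeOn (N : ℕ) (X Y : Array ℤ) : Bool := (List.range N).all fun i => X.getD i 0 == Y.getD i 0

/-- **Fast Bernstein certificate** (the certificate of `Bern.certifyA`, table arithmetic): the proposed scaled Bernstein
coefficients are nonnegative and transform back to `A`. [this work] -/
def certifyTW (n d : ℕ) (AL : Array (Array (Fin (d + 1)) × Array (Array ℕ))) (A : Array ℤ) : Bool :=
  let B := fwdTW n d AL A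
  nonnegOn ((d + 1) ^ n) B && agreeOn ((d + 1) ^ n) (backTW n d AL (List.finRange n) B) A

/-- **Soundness of the fast certificate**: a certified table is nonnegative on the unit cube. [this work] -/
theorem eval_nonneg_of_certifyTW {d : ℕ} {A : Array ℤ} (h : certifyTW n d (alTabs n d) A = true) {x : Fin n → ℝ}
    (hx : ∀ i, 0 ≤ x i ∧ x i ≤ 1) : 0 ≤ eval (ofTable n d A) x := by
  simp only [certifyTW, Bool.and_eq_true, nonnegOn, agreeOn, List.all_eq_true, List.mem_range, decide_eq_true_eq,
    beq_iff_eq] at h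
  obtain ⟨hnn, hag⟩ := h
  set B := fwdTW n d (alTabs n d) A with hB
  have hEq : ofTable n d (backTW n d (alTabs n d) (List.finRange n) B) = ofTable n d A := by
    funext e
    simp only [ofTable]
    exact hag _ (encode_lt n e)
  have hback : ofTable n d (backLA n d (List.finRange n) B) = ofTable n d A := by
    rw [← hEq, ofTable_backTW, ofTable_backLA]
  rw [← hback, eval_backLA]
  exact evalB_univ_nonneg (fun j => hnn _ (encode_lt n j)) hx

/-! ### Products -/

/-- Digitwise compatibility `e₂ ≤ e ≤ e₂ + a`. [this work] -/
def CompatE {a b : ℕ} (e : Expo n (a + b)) (e₂ : Expo n b) : Prop := ∀ i, (e₂ i : ℕ) ≤ (e i : ℕ) ∧ (e i : ℕ) ≤ (e₂ i : ℕ) + a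

/-- `CompatE` is decidable. [this work] -/
instance instDecCompatE {a b : ℕ} (e : Expo n (a + b)) (e₂ : Expo n b) : Decidable (CompatE e e₂) := by
  unfold CompatE; infer_instance

/-- Truncated digitwise difference (the true difference under `CompatE`). [this work] -/
def subE {a b : ℕ} (e : Expo n (a + b)) (e₂ : Expo n b) : Expo n a := fun i => ⟨min ((e i : ℕ) - e₂ i) a, by omega⟩

/-- For every output index and second-factor index: the first-factor index, if compatible. [this work] -/
def subTab (n a b : ℕ) : Array (Array (Option ℕ)) :=
  Array.ofFn fun idx : Fin ((a + b + 1) ^ n) => Array.ofFn fun idx₂ : Fin ((b + 1) ^ n) =>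
    if CompatE (decode (d := a + b) n idx) (decode (d := b) n idx₂) then
      some (encode n (subE (decode (d := a + b) n idx) (decode (d := b) n idx₂)))
    else none

/-- One summand of the table product: `A[j]·B[i₂]` if the row assigns a first-factor index `j` to `i₂`. [this work] -/
def mulTerm (A B : Array ℤ) (row : Array (Option ℕ)) (i₂ : ℕ) : ℤ :=
  match row.getD i₂ none with
  | some j => A.getD j 0 * B.getD i₂ 0
  | none => 0

/-- Product of a degree-`a` and a degree-`b` table, given the index table — TABLE version of `Bern.mulFast`. [this work] -/
def mulTW (n a b : ℕ) (ST : Array (Array (Option ℕ))) (A B : Array ℤ) : Array ℤ :=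
  Array.ofFn fun idx : Fin ((a + b + 1) ^ n) =>
    let row := ST.getD idx #[]
    sumBelow ((b + 1) ^ n) fun i _ => mulTerm A B row i

/-- `mulTW` with the canonical table computes `mulFast`. [this work] -/
theorem ofTable_mulTW {a b : ℕ} (A B : Array ℤ) :
    ofTable n (a + b) (mulTW n a b (subTab n a b) A B) = mulFast (ofTable n a A) (ofTable n b B) := by
  funext e
  have he := encode_lt n e
  rw [ofTable, mulTW, getD_ofFn _ he]
  simp only [sumBelow_eq]
  unfold mulFast
  symm
  refine Fintype.sum_equiv (expoEquiv n b) _ _ fun e₂ => ?_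
  change _ = mulTerm A B ((subTab n a b).getD (encode n e) #[]) (encode n e₂)
  have hrow : ((subTab n a b).getD (encode n e) #[]).getD (encode n e₂) none =
      if CompatE e e₂ then some (encode n (subE e e₂)) else none := by
    rw [subTab, getD_ofFn _ he, getD_ofFn _ (encode_lt n e₂)]; simp only [decode_encode]
  rw [mulTerm, hrow]
  by_cases hc : CompatE e e₂
  · have hc' : ∀ i, (e₂ i : ℕ) ≤ (e i : ℕ) ∧ (e i : ℕ) ≤ (e₂ i : ℕ) + a := hc
    simp only [dif_pos hc', if_pos hc]
    have hsub : (fun i => (⟨(e i : ℕ) - e₂ i, by have := hc' i; omega⟩ : Fin (a + 1))) = subE e e₂ := by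
      funext i; apply Fin.ext; simp only [subE]; have := hc' i; omega
    rw [hsub]
    rfl
  · have hc' : ¬ ∀ i, (e₂ i : ℕ) ≤ (e i : ℕ) ∧ (e i : ℕ) ≤ (e₂ i : ℕ) + a := hc
    simp only [dif_neg hc', if_neg hc]

/-- Evaluation of a table product. [this work] -/
theorem eval_mulTW {a b : ℕ} (A B : Array ℤ) (x : Fin n → ℝ) :
    eval (ofTable n (a + b) (mulTW n a b (subTab n a b) A B)) x = eval (ofTable n a A) x * eval (ofTable n b B) x := by
  rw [ofTable_mulTW, mulFast_eq, eval_mul]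

/-! ### All index tables of dimension `n`, built once -/

/-- The index tables used by the fast (C1) check in dimension `n`. [this work] -/
structure Tabs (n : ℕ) where
  /-- product index table, degrees `1 × 1` -/
  st11 : Array (Array (Option ℕ))
  /-- product index table, degrees `2 × 1` -/
  st21 : Array (Array (Option ℕ))
  /-- along-coordinate tables, degree `1` -/
  al1 : Array (Array (Fin 2) × Array (Array ℕ))
  /-- along-coordinate tables, degree `2` -/
  al2 : Array (Array (Fin 3) × Array (Array ℕ))
  /-- along-coordinate tables, degree `3` -/
  al3 : Array (Array (Fin 4) × Array (Array ℕ))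
  /-- sub-cube membership of 3-fibres in 2-fibres -/
  ct : Array (Array Bool)
  /-- for every 2-fibre index and point index: is the point in the sub-cube? -/
  pt : Array (Array Bool)

/-- A 3-fibre `α` belongs to the sub-cube of the 2-fibre `β`. [this work] -/
def compatB (β : Expo n 2) (α : Expo n 3) : Bool :=
  decide (∀ i : Fin n, ((β i : ℕ) = 2 → (α i : ℕ) = 3) ∧ ((β i : ℕ) = 0 → (α i : ℕ) = 0))

/-- A point (as a 0/1 exponent vector) belongs to the sub-cube of the 2-fibre `β`. [this work] -/
def compatP (β : Expo n 2) (p : Expo n 1) : Bool :=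
  decide (∀ i : Fin n, ((β i : ℕ) = 2 → (p i : ℕ) = 1) ∧ ((β i : ℕ) = 0 → (p i : ℕ) = 0))

/-- **The canonical index tables of dimension `n`.** [this work] -/
def mkTabs (n : ℕ) : Tabs n where
  st11 := subTab n 1 1
  st21 := subTab n 2 1
  al1 := alTabs n 1
  al2 := alTabs n 2
  al3 := alTabs n 3
  ct := Array.ofFn fun b : Fin (3 ^ n) => Array.ofFn fun a : Fin (4 ^ n) => compatB (decode (d := 2) n b) (decode (d := 3) n a)
  pt := Array.ofFn fun b : Fin (3 ^ n) => Array.ofFn fun p : Fin (2 ^ n) => compatP (decode (d := 2) n b) (decode (d := 1) n p)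

end C1Cert

end SafeCalc

end Summit.CriticalPhenomena.PercolationContinuityZ3.Theorems.SunflowerPartition
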